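import Mathlib
import HarnessLib
import Summits.QuantumFields.YangMills.Theses.ScalingWindowSplit
import Summits.QuantumFields.YangMills.Theorems.MirrorModularBoostsHypercubicLimitOfLineInputs
import Summits.QuantumFields.YangMills.Theorems.MirrorModularBoostsHypercubicLimitCovBookkeeping
import Summits.QuantumFields.YangMills.Theorems.HypercubicLimit.Negative.TruncatedOSForm
import Literature.MathematicalPhysics.QuantumLattice.EuclideanAction

/-!
# Route `ScalingWindowSplit`, support item `ExistenceLegFromLattice` (stmt-QuantumFields-18657)

THE TYPED SPLIT of the route: the three lattice items
`GapAtCorrelationLength` (W₁, IR, renormalisation-free, `∃` over `(r, sch, u, p, M, Δ, C)`),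
`SelfNormalisedSkewness` (W₂, `κ₃` floor of the self-normalised field) and
`SelfNormalisedMomentBounds` (U, `k`-uniform plane-resolved `n!`-moment bounds of the self-normalised field)
imply the shared existence leg `CoincidenceRotationBootstrap.HypercubicLimit` (stmt-QuantumFields-16154) BY NAME.

Proof (the renormalisation seam, then the landed coupling-response chain p136824):

* `smearedLatticeField_affine` — the renormalised smeared field is affine in the bare one,
  `Φ^{c,m}(f) = c · Φ^{1,0}(f) − c a⁴ m Σₓ f(a x)`;
* `trunc_eq_covariance` (the landed `stub_covBookkeeping`) and `trunc_rescale` — hence the truncated lattice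
  two-point function of ANY scheme is `c_k²` times the BARE one (covariances are blind to additive constants and
  bilinear): the seam identity;
* `oneField_of_latticeInequalities` — for the canonically SELF-NORMALISED scheme `canon`
  (`c'_k = 1/√T⁰_k(u,θu)`, `m'_k = ⟨tr U_p⟩_k`) the seam identity and the polynomial floor `a_k^p ≤ T⁰_k(u,θu)` give
  `T^canon_k(u,θu) = 1` eventually (the non-triviality floor of `IRInputs`, clause (c), with `v = θu`),
  `PolyRenorm` on the tail (`1/√T⁰ ≤ a⁻ᵖ` once `a ≤ 1`), a bounded counterterm (`|m'_k| ≤ sup |tr F²|`, Wilson's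
  measure being a probability measure), while the gap clauses (a), (b) of `IRInputs` never read `(c, m)` and (d) is W₂;
  after the tail shift `subseq canon (· + k₀)` the landed `oneFieldClauses_of_uniformMomentBoundsPlanes` applies;
* `existenceLegFromLattice_proof` — fix `G`, take W₁'s witness, feed U and W₂ at it, and conclude by the landed
  reduction `hypercubicLimit_iff_oneFieldWeak` (ONE FIELD SUFFICES).

References: Glimm–Jaffe, *Quantum Physics* (1987) §6.1, §19.1 (truncated functions, renormalisation);
Osterwalder–Seiler, Ann. Phys. 110 (1978) §2.  No definitions, no notation, no named facts.
-/

noncomputable section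

open scoped SchwartzMap BigOperators Topology Classical MeasureTheory ProbabilityTheory Matrix
open MeasureTheory ProbabilityTheory Filter Topology
open Literature.MathematicalPhysics.AQFT Literature.MathematicalPhysics.QuantumLattice
open Literature.MathematicalPhysics.QuantumFieldTheory
open Summit.QuantumFields.YangMills.Cruxes.HypercubicLimit.CouplingResponse

namespace Summit.QuantumFields.YangMills.Theorems.ScalingWindowSplit

/-! ## The renormalisation seam -/

section Seam

variable {G : Type}

/-- **Affine renormalisation, pointwise.**  The smeared field renormalised by `(c, m)` is affine in the bare
(`c = 1`, `m = 0`) smeared field: `Φ^{c,m}_a(f)(U) = c · Φ^{1,0}_a(f)(U) − c a⁴ Σₓ f(a x) m`. [folklore] -/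
theorem smearedLatticeField_affine [MeasurableSpace G] (O : LGConfig 4 G → ℝ)
    (Λ : Finset (Literature.Probability.LatticeModels.Site 4))
    (a c m : ℝ) (f : 𝓢(EuclideanSpace ℝ (Fin 4), ℝ)) (V : LGConfig 4 G) :
    smearedLatticeField O Λ a c m f V =
      c * smearedLatticeField O Λ a 1 0 f V - c * a ^ 4 * ∑ x ∈ Λ, f (a • siteToE x) * m := by
  simp only [smearedLatticeField, one_mul, sub_zero, mul_sub, Finset.sum_sub_distrib]
  ring

variable [Group G] [TopologicalSpace G] [IsTopologicalGroup G] [CompactSpace G] [MeasurableSpace G]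
  [BorelSpace G]

/-- A smeared lattice field of a species (bounded, measurable), read on the periodic lift of the torus, is
integrable for Wilson's measure (a probability measure for a continuous representation). [folklore] -/
theorem integrable_smearedLatticeField (r : LatticeRep G) (s : YMSpecies G)
    (Λ : Finset (Literature.Probability.LatticeModels.Site 4)) (a c m β : ℝ)
    (f : 𝓢(EuclideanSpace ℝ (Fin 4), ℝ)) (Sd : ℕ) [NeZero Sd] :
    Integrable (fun U : GaugeConfig 4 Sd G => smearedLatticeField s.F Λ a c m f (torusLift Sd U))
      (wilsonMeasure r.ρ β : Measure (GaugeConfig 4 Sd G)) := by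
  haveI : IsProbabilityMeasure (wilsonMeasure (d := 4) (L := Sd) (G := G) r.ρ β) :=
    isProbabilityMeasure_wilsonMeasure r.ρ r.continuous β
  obtain ⟨B, hB⟩ := exists_bound_smearedLatticeField s.bounded Λ a c m f
  exact Integrable.of_bound
    (measurable_smearedLatticeField_torusLift s Λ a c m f Sd).aestronglyMeasurable B
    (ae_of_all _ fun U => by rw [Real.norm_eq_abs]; exact hB _)

/-- **Covariances of renormalised smeared fields scale by `c²`.**  On a torus of side `Sd` under Wilson's measure,
`Cov(Φ^{c,m}(f), Φ^{c,m}(g)) = c² Cov(Φ^{1,0}(f), Φ^{1,0}(g))` for the smeared curvature fields: the renormalised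
field is `c` times the bare field plus a constant (`smearedLatticeField_affine`), and covariances are bilinear
and blind to additive constants. [cite: GlimmJaffe1987, §6.1 and §19.1] -/
theorem covariance_smearedLatticeField_rescale (r : LatticeRep G)
    (Λ : Finset (Literature.Probability.LatticeModels.Site 4)) (a c m β : ℝ)
    (f g : 𝓢(EuclideanSpace ℝ (Fin 4), ℝ)) (Sd : ℕ) [NeZero Sd] :
    cov[fun U : GaugeConfig 4 Sd G => smearedLatticeField r.curvature.F Λ a c m f (torusLift Sd U),
        fun U : GaugeConfig 4 Sd G => smearedLatticeField r.curvature.F Λ a c m g (torusLift Sd U);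
        (wilsonMeasure r.ρ β : Measure (GaugeConfig 4 Sd G))] =
      c ^ 2 *
        cov[fun U : GaugeConfig 4 Sd G => smearedLatticeField r.curvature.F Λ a 1 0 f (torusLift Sd U),
          fun U : GaugeConfig 4 Sd G => smearedLatticeField r.curvature.F Λ a 1 0 g (torusLift Sd U);
          (wilsonMeasure r.ρ β : Measure (GaugeConfig 4 Sd G))] := by
  haveI : IsProbabilityMeasure (wilsonMeasure (d := 4) (L := Sd) (G := G) r.ρ β) :=
    isProbabilityMeasure_wilsonMeasure r.ρ r.continuous β
  have hX := integrable_smearedLatticeField r r.curvature Λ a 1 0 β f Sd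
  have hY := integrable_smearedLatticeField r r.curvature Λ a 1 0 β g Sd
  simp only [smearedLatticeField_affine r.curvature.F Λ a c m]
  rw [covariance_sub_const_left (hX.const_mul _), covariance_sub_const_right (hY.const_mul _),
    covariance_const_mul_left, covariance_const_mul_right]
  ring

/-- **The truncated lattice two-point function is a covariance** (the landed `stub_covBookkeeping`, read at
arity `1 + 1`): `𝔖₂(f ⊗ g) − 𝔖₁(f) 𝔖₁(g) = Cov_{μ_k}(Φ_k(f), Φ_k(g))` for the smeared renormalised curvature
fields under Wilson's measure `μ_k` of the scheme at step `k`. [folklore] -/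
theorem trunc_eq_covariance (r : LatticeRep G) (S : SpeciesScheme (YMSpecies G)) (k : ℕ)
    (f g : 𝓢(EuclideanSpace ℝ (Fin 4), ℝ)) :
    latticeSchwinger r.ρ S (fun s => s.F) k (1 + 1) (fun _ => r.curvature) ![f, g] -
        latticeSchwinger r.ρ S (fun s => s.F) k 1 (fun _ => r.curvature) ![f] *
          latticeSchwinger r.ρ S (fun s => s.F) k 1 (fun _ => r.curvature) ![g] =
      cov[fun U => smearedLatticeField r.curvature.F (Literature.Probability.LatticeModels.box 4 (S.L k))
          (S.a k) (S.c r.curvature k) (S.m r.curvature k) f (torusLift (S.side k) U),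
        fun U => smearedLatticeField r.curvature.F (Literature.Probability.LatticeModels.box 4 (S.L k))
          (S.a k) (S.c r.curvature k) (S.m r.curvature k) g (torusLift (S.side k) U);
        (wilsonMeasure r.ρ (S.β k) : Measure (GaugeConfig 4 (S.side k) G))] :=
  (stub_covBookkeeping G r S k f g).symm

/-- **The seam identity.**  The truncated lattice two-point function of the curvature for ANY scheme `S` is
`c_k²` times that of the BARE scheme (`c ≡ 1`, `m ≡ 0`, same spacings, couplings and tori).
[cite: GlimmJaffe1987, §6.1 and §19.1] -/
theorem trunc_rescale (r : LatticeRep G) (S : SpeciesScheme (YMSpecies G)) (k : ℕ)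
    (f g : 𝓢(EuclideanSpace ℝ (Fin 4), ℝ)) :
    latticeSchwinger r.ρ S (fun s => s.F) k (1 + 1) (fun _ => r.curvature) ![f, g] -
        latticeSchwinger r.ρ S (fun s => s.F) k 1 (fun _ => r.curvature) ![f] *
          latticeSchwinger r.ρ S (fun s => s.F) k 1 (fun _ => r.curvature) ![g] =
      S.c r.curvature k ^ 2 *
        (latticeSchwinger r.ρ ({ S with c := fun _ _ => 1, m := fun _ _ => 0 } : SpeciesScheme (YMSpecies G))
            (fun s => s.F) k (1 + 1) (fun _ => r.curvature) ![f, g] -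
          latticeSchwinger r.ρ ({ S with c := fun _ _ => 1, m := fun _ _ => 0 } : SpeciesScheme (YMSpecies G))
              (fun s => s.F) k 1 (fun _ => r.curvature) ![f] *
            latticeSchwinger r.ρ ({ S with c := fun _ _ => 1, m := fun _ _ => 0 } : SpeciesScheme (YMSpecies G))
              (fun s => s.F) k 1 (fun _ => r.curvature) ![g]) := by
  rw [trunc_eq_covariance, trunc_eq_covariance,
    covariance_smearedLatticeField_rescale r _ _ (S.c r.curvature k) (S.m r.curvature k)]
  rfl

/-- `k`-uniform plane-resolved moment bounds restrict to sub-schemes (the clause is `∀ k` and reads the scheme's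
data at `k`; definitional bookkeeping for `subseq`). [folklore] -/
theorem uniformMomentBoundsPlanes_subseq (r : LatticeRep G) (S : SpeciesScheme (YMSpecies G))
    (φ : ℕ → ℕ) (hφ : StrictMono φ) (h : UniformMomentBoundsPlanes r S) :
    UniformMomentBoundsPlanes r (subseq S φ hφ) := by
  obtain ⟨s, C₀, C₁, h⟩ := h
  exact ⟨s, C₀, C₁, fun n F hF hD k => h n F hF hD (φ k)⟩

/-- Time reflection maps a negative-time bump to a positive-time one (restated from the landed
`Negative.tsupport_thetaTest_pos` for the local `open`s). [folklore] -/
theorem tsupport_thetaTest_pos' {u : 𝓢(EuclideanSpace ℝ (Fin 4), ℝ)}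
    (hu : tsupport u ⊆ {y : EuclideanSpace ℝ (Fin 4) | y 0 < 0}) :
    tsupport (thetaTest 4 u) ⊆ {y : EuclideanSpace ℝ (Fin 4) | 0 < y 0} :=
  Summit.QuantumFields.YangMills.Theorems.HypercubicLimit.Negative.tsupport_thetaTest_pos hu

/-- **The seam, assembled: from the three lattice inequalities at one witness to the one-field clauses.**
Given `r`, a scheme `sch` at weak coupling with polynomial volume growth, `Δ > 0` with the uniform lattice gap and
its RP-spectral form, a negative-time bump `u` with the polynomial floor and the window of the BARE truncated
two-point function `T⁰_k(u, θu)`, the `k`-uniform plane-resolved moment bounds of the SELF-NORMALISED scheme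
`canon` (`c'_k = 1/√T⁰_k(u,θu)`, `m'_k = ⟨tr U_p⟩_k`) and a `κ₃` floor for `canon`: there are a sub-scheme at weak
coupling and a one-field Schwinger family with `OneFieldClauses`.  Proof: `T^canon_k(u,θu) = c'_k² T⁰_k = 1` on the
tail where the floor holds (`trunc_rescale`) gives clause (c) of `IRInputs r canon` with `v = θu`, `δ = 1`; clauses
(a), (b) are those of `sch` (they read `a, β, L` only) and (d) is the hypothesis; on the tail `k ≥ k₀` (floor and
`a_k ≤ 1`) `|c'_k| = 1/√T⁰_k ≤ a_k⁻ᵖ` (`PolyRenorm`) and `|m'_k| ≤ sup |tr F²|`; the tail sub-scheme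
`subseq canon (· + k₀)` keeps weak coupling, polynomial volumes, the moment bounds and `IRInputs`, so the landed
`oneFieldClauses_of_uniformMomentBoundsPlanes` applies. [cite: GlimmJaffe1987, §6.1 and §19.1] -/
theorem oneField_of_latticeInequalities (r : LatticeRep G) (sch : SpeciesScheme (YMSpecies G))
    (u : 𝓢(EuclideanSpace ℝ (Fin 4), ℝ)) (p : ℕ) (M Δ C : ℝ) :
    let bare : SpeciesScheme (YMSpecies G) := { sch with c := fun _ _ => 1, m := fun _ _ => 0 }
    let T : 𝓢(EuclideanSpace ℝ (Fin 4), ℝ) → ℕ → ℝ := fun w k =>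
      latticeSchwinger r.ρ bare (fun s => s.F) k (1 + 1) (fun _ => r.curvature) ![w, thetaTest 4 w] -
        latticeSchwinger r.ρ bare (fun s => s.F) k 1 (fun _ => r.curvature) ![w] *
          latticeSchwinger r.ρ bare (fun s => s.F) k 1 (fun _ => r.curvature) ![thetaTest 4 w]
    let canon : SpeciesScheme (YMSpecies G) :=
      { sch with
        c := fun _ k => (Real.sqrt (T u k))⁻¹
        m := fun _ k => ∫ U, r.curvature.F (torusLift (sch.side k) U) ∂(wilsonMeasure r.ρ (sch.β k)) }
    sch.HasWeakCouplingLimit →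
    (∃ N : ℕ, 1 ≤ N ∧ ∀ᶠ k in Filter.atTop, (sch.a k)⁻¹ ≤ (sch.a k * (sch.L k : ℝ)) ^ N) →
    0 < Δ → HasLatticeMassGap r sch Δ →
    (∀ᶠ k in Filter.atTop, ∀ (S₀ T₀ n : ℕ), sch.L k ≤ S₀ → 2 * (T₀ + n + 1) ≤ S₀ →
      ∀ (Y : LGConfig 4 G → ℝ) (B : ℝ), Measurable Y → (∀ U, |Y U| ≤ B) →
        DependsOn Y {e : Literature.MathematicalPhysics.QuantumLattice.ZdEdge 4 |
          1 ≤ e.1 0 ∧ e.1 0 + (if e.2 = 0 then 1 else 0) ≤ T₀} →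
        |(∫ U, Y (torusLift (2 * S₀ + 1) (GaugeConfig.timeReflect U)) *
              Y (configShift (-Pi.single 0 (n : ℤ)) (torusLift (2 * S₀ + 1) U))
            ∂(wilsonMeasure r.ρ (sch.β k) : Measure (GaugeConfig 4 (2 * S₀ + 1) G))) -
          (∫ U, Y (torusLift (2 * S₀ + 1) U)
            ∂(wilsonMeasure r.ρ (sch.β k) : Measure (GaugeConfig 4 (2 * S₀ + 1) G))) ^ 2| ≤
          Real.exp (-(Δ * sch.a k * n)) *
            ((∫ U, Y (torusLift (2 * S₀ + 1) (GaugeConfig.timeReflect U)) * Y (torusLift (2 * S₀ + 1) U)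
                ∂(wilsonMeasure r.ρ (sch.β k) : Measure (GaugeConfig 4 (2 * S₀ + 1) G))) -
              (∫ U, Y (torusLift (2 * S₀ + 1) U)
                ∂(wilsonMeasure r.ρ (sch.β k) : Measure (GaugeConfig 4 (2 * S₀ + 1) G))) ^ 2) +
          C * B ^ 2 * Real.exp (-(Δ * sch.a k * S₀))) →
    tsupport u ⊆ {y : EuclideanSpace ℝ (Fin 4) | y 0 < 0} →
    (∀ᶠ k in Filter.atTop, (sch.a k) ^ p ≤ T u k ∧ T u k ≤ M * T (timeShiftTest 4 (-1) u) k) →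
    (∃ (s : ℕ) (C₀ C₁ : ℝ), ∀ (n : ℕ)
        (F : Fin n → {q : Fin 4 × Fin 4 // q.1 < q.2} → 𝓢(EuclideanSpace ℝ (Fin 4), ℝ)),
      (∀ i, ∑ q, schwartzNorm s (ofRealTest (F i q)) ≤ 1) →
      (∀ i j, i ≠ j → ∀ q q', Disjoint (tsupport (F i q)) (tsupport (F j q'))) →
      ∀ k : ℕ, |∫ U, ∏ i, ∑ q : {q : Fin 4 × Fin 4 // q.1 < q.2},
        smearedLatticeField (plaquetteObs r.ρ 0 q.1.1 q.1.2)
          (Literature.Probability.LatticeModels.box 4 (canon.L k)) (canon.a k) (canon.c r.curvature k)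
          (canon.m r.curvature k / 6) (F i q) (torusLift (canon.side k) U)
        ∂(wilsonMeasure r.ρ (canon.β k) : Measure (GaugeConfig 4 (canon.side k) G))| ≤
        C₀ * C₁ ^ n * n.factorial) →
    (∃ (f g h : 𝓢(EuclideanSpace ℝ (Fin 4), ℝ)) (δ : ℝ),
      Disjoint (tsupport f) (tsupport g) ∧ Disjoint (tsupport f) (tsupport h) ∧
      Disjoint (tsupport g) (tsupport h) ∧ 0 < δ ∧
      ∀ᶠ k in Filter.atTop, δ ≤
        |latticeSchwinger r.ρ canon (fun s => s.F) k 3 (fun _ => r.curvature) ![f, g, h] -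
          latticeSchwinger r.ρ canon (fun s => s.F) k 1 (fun _ => r.curvature) ![f] *
            latticeSchwinger r.ρ canon (fun s => s.F) k 2 (fun _ => r.curvature) ![g, h] -
          latticeSchwinger r.ρ canon (fun s => s.F) k 1 (fun _ => r.curvature) ![g] *
            latticeSchwinger r.ρ canon (fun s => s.F) k 2 (fun _ => r.curvature) ![f, h] -
          latticeSchwinger r.ρ canon (fun s => s.F) k 1 (fun _ => r.curvature) ![h] *
            latticeSchwinger r.ρ canon (fun s => s.F) k 2 (fun _ => r.curvature) ![f, g] +
          2 * (latticeSchwinger r.ρ canon (fun s => s.F) k 1 (fun _ => r.curvature) ![f] *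
            latticeSchwinger r.ρ canon (fun s => s.F) k 1 (fun _ => r.curvature) ![g] *
            latticeSchwinger r.ρ canon (fun s => s.F) k 1 (fun _ => r.curvature) ![h])|) →
    ∃ (sch' : SpeciesScheme (YMSpecies G)) (S₁ : SchwingerFamily (EuclideanSpace ℝ (Fin 4))),
      sch'.HasWeakCouplingLimit ∧ OneFieldClauses r sch' S₁ := by
  intro bare T canon hw hpv hΔ hgap hrp hu hfw hUMB hK3
  -- the tail `k ≥ k₀`: floor ∧ window, and `a_k ≤ 1`
  have ha1 : ∀ᶠ k in atTop, sch.a k ≤ 1 := sch.tendsto_a.eventually_le_const zero_lt_one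
  obtain ⟨k₀, hk₀⟩ := Filter.eventually_atTop.1 (hfw.and ha1)
  have hTpos : ∀ k, k₀ ≤ k → 0 < T u k := fun k hk =>
    (pow_pos (sch.a_pos k) p).trans_le (hk₀ k hk).1.1
  -- the seam identity for the self-normalised scheme: `T^canon_k(u, θu) = 1` on the tail
  have hone : ∀ k, k₀ ≤ k →
      latticeSchwinger r.ρ canon (fun s => s.F) k (1 + 1) (fun _ => r.curvature) ![u, thetaTest 4 u] -
          latticeSchwinger r.ρ canon (fun s => s.F) k 1 (fun _ => r.curvature) ![u] *
            latticeSchwinger r.ρ canon (fun s => s.F) k 1 (fun _ => r.curvature) ![thetaTest 4 u] = 1 := by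
    intro k hk
    rw [trunc_rescale r canon k u (thetaTest 4 u)]
    have hc : canon.c r.curvature k = (Real.sqrt (T u k))⁻¹ := rfl
    have hb : latticeSchwinger r.ρ ({ canon with c := fun _ _ => 1, m := fun _ _ => 0 } :
          SpeciesScheme (YMSpecies G)) (fun s => s.F) k (1 + 1) (fun _ => r.curvature) ![u, thetaTest 4 u] -
        latticeSchwinger r.ρ ({ canon with c := fun _ _ => 1, m := fun _ _ => 0 } :
            SpeciesScheme (YMSpecies G)) (fun s => s.F) k 1 (fun _ => r.curvature) ![u] *
          latticeSchwinger r.ρ ({ canon with c := fun _ _ => 1, m := fun _ _ => 0 } :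
            SpeciesScheme (YMSpecies G)) (fun s => s.F) k 1 (fun _ => r.curvature) ![thetaTest 4 u] =
        T u k := rfl
    rw [hc, hb, inv_pow, Real.sq_sqrt (hTpos k hk).le, inv_mul_cancel₀ (hTpos k hk).ne']
  -- the infrared inputs of `canon`: (a), (b) from `sch`; (c) the identity; (d) the hypothesis
  have hIR : IRInputs r canon := by
    refine ⟨⟨Δ, C, hΔ, hgap, hrp⟩, ⟨u, thetaTest 4 u, 1, hu, tsupport_thetaTest_pos' hu, one_pos, ?_⟩, hK3⟩
    exact Filter.eventually_atTop.2 ⟨k₀, fun k hk => by rw [hone k hk, abs_one]⟩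
  -- the tail sub-scheme
  have hφ : StrictMono fun k : ℕ => k + k₀ := fun a b h => Nat.add_lt_add_right h k₀
  refine oneFieldClauses_of_uniformMomentBoundsPlanes r (subseq canon (fun k => k + k₀) hφ)
    (hasWeakCouplingLimit_subseq canon _ hφ hw) (polyVolume_subseq canon _ hφ hpv) ?_ ?_
    (uniformMomentBoundsPlanes_subseq r canon _ hφ hUMB) (irInputs_subseq G r canon _ hφ hIR)
  · -- `PolyRenorm` on the tail: `|c'_k| = 1/√T⁰_k ≤ a_k⁻ᵖ`
    refine ⟨p, fun k => ?_⟩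
    show |(Real.sqrt (T u (k + k₀)))⁻¹| ≤ (sch.a (k + k₀))⁻¹ ^ p
    obtain ⟨⟨hfl, -⟩, hak⟩ := hk₀ (k + k₀) (Nat.le_add_left k₀ k)
    have hT : 0 < T u (k + k₀) := hTpos _ (Nat.le_add_left k₀ k)
    have ha : 0 < sch.a (k + k₀) := sch.a_pos _
    rw [abs_of_pos (inv_pos.2 (Real.sqrt_pos.2 hT)), inv_pow]
    refine inv_anti₀ (pow_pos ha p) (Real.le_sqrt_of_sq_le ?_)
    calc (sch.a (k + k₀) ^ p) ^ 2 = sch.a (k + k₀) ^ p * sch.a (k + k₀) ^ p := sq _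
      _ ≤ sch.a (k + k₀) ^ p * 1 :=
        mul_le_mul_of_nonneg_left (pow_le_one₀ ha.le hak) (pow_nonneg ha.le p)
      _ ≤ T u (k + k₀) := by rw [mul_one]; exact hfl
  · -- bounded counterterm: `|m'_k| ≤ sup |tr F²|`
    obtain ⟨Cm, hCm⟩ := r.curvature.bounded
    refine ⟨Cm, fun k => ?_⟩
    show |∫ U, r.curvature.F (torusLift (sch.side (k + k₀)) U)
        ∂(wilsonMeasure r.ρ (sch.β (k + k₀)) : Measure (GaugeConfig 4 (sch.side (k + k₀)) G))| ≤ Cm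
    haveI : IsProbabilityMeasure
        (wilsonMeasure (d := 4) (L := sch.side (k + k₀)) (G := G) r.ρ (sch.β (k + k₀))) :=
      isProbabilityMeasure_wilsonMeasure r.ρ r.continuous _
    have h := norm_integral_le_of_norm_le_const
      (μ := (wilsonMeasure r.ρ (sch.β (k + k₀)) : Measure (GaugeConfig 4 (sch.side (k + k₀)) G)))
      (f := fun U => r.curvature.F (torusLift (sch.side (k + k₀)) U)) (C := Cm)
      (ae_of_all _ fun U => by rw [Real.norm_eq_abs]; exact hCm _)
    simpa using h

end Seam

/-- **Support item `ExistenceLegFromLattice`** of route `ScalingWindowSplit` (stmt-QuantumFields-18657), THE TYPED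
SPLIT: `GapAtCorrelationLength → SelfNormalisedSkewness → SelfNormalisedMomentBounds →
CoincidenceRotationBootstrap.HypercubicLimit`.  Fix a compact simple `G`; W₁ gives `(r, sch, u, p, M, Δ, C)`; U and
W₂ at that witness give the self-normalised moment bounds and the `κ₃` floor; the seam
(`oneField_of_latticeInequalities`) gives a weak-coupling scheme with the one-field clauses, and ONE FIELD
SUFFICES (`hypercubicLimit_iff_oneFieldWeak`). [cite: GlimmJaffe1987, §6.1 and §19.1] -/
theorem existenceLegFromLattice_proof :
    Summit.QuantumFields.YangMills.Theses.ScalingWindowSplit.ExistenceLegFromLattice := by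
  unfold Summit.QuantumFields.YangMills.Theses.ScalingWindowSplit.ExistenceLegFromLattice
  intro hW hS hU
  refine Summit.QuantumFields.YangMills.Theorems.HypercubicLimit.OneFieldWeak.hypercubicLimit_iff_oneFieldWeak.mpr
    fun G _ _ _ _ hG => ?_
  letI : MeasurableSpace G := borel G
  haveI : BorelSpace G := ⟨rfl⟩
  obtain ⟨r, sch, u, p, M, Δ, C, hw, hpv, hΔ, hgap, hrp, hu, hfw⟩ := hW G hG
  obtain ⟨sch', S₁, hw', h₁⟩ := oneField_of_latticeInequalities r sch u p M Δ C hw hpv hΔ hgap hrp hu hfw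
    (hU G r sch u p M hw hpv hfw) (hS G r sch u p M hw hpv hu hfw)
  exact ⟨r, sch', S₁, hw', h₁⟩

end Summit.QuantumFields.YangMills.Theorems.ScalingWindowSplit

end
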